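import Literature.AnabelianGeometry.AbsoluteAnabelian.HolomorphicEllipticCuspidalizationTorsionProofs
import Literature.AnabelianGeometry.AbsoluteAnabelian.HolomorphicEllipticCuspidalizationProofs
import Literature.AnabelianGeometry.AbsoluteAnabelian.HolomorphicEllipticCuspidalizationFiniteEtale
import Literature.AnabelianGeometry.AbsoluteAnabelian.HolomorphicEllipticCuspidalizationDeck
import HarnessLib

/-!
# [AbsTopIII] Cor 2.7 (b) at the model: the cuspidal torsion points ARE the non-zero torsion points

PROOF-ONLY assembly (no definitions, no named facts) for the sub-DAG `plan/L4/SUBDAG-AbsTopIII-Cor-27.md`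
of the cell abc-iut (row Cor-27.b, r9 ⊇ + r10 (b).8 ⊆), seat abc-iut-w5-d208.  S. Mochizuki, *Topics in
absolute anabelian geometry III*, §2, Corollary 2.7 (b), kurims p. 59: "one may construct the torsion
points of [the elliptic curve determined by] `𝔼` as the points in the complement of the image of such
morphisms `𝕌 ↪ 𝔼`".  The printed "as" is an EQUALITY of sets; the tree proved the two inclusions
separately — `⊇` from the sub-nodes (b).1–(b).6 (all LANDED: `nsmulCovIsFiniteEtale_holds` p414959,
`nsmulDeckAbelianTransitive_holds` p415902, `nsmulCovIsMorphism_holds` / `nsmulImmIsMorphism_holds` /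
`nsmulImmComplement_holds` / `nsmulCoholomorphic_holds` p416327, composed by
`mem_cuspidalTorsionPoints_of_nsmul_eq_zero` p414370) and `⊆` = (b).8
(`cuspidalTorsionPointsAreTorsion_of`, p417839, abc-iut-w5-d053, GRANTED [AbsTopIII] Cor 2.3 (i)
`LocalMorphismIsRCHolomorphic` BY NAME).  This file records the equality they give together:

* `cuspidalTorsionPoints_eq_of` — granted Cor 2.3 (i), for every period isomorphism `Φ`,
  `cuspidalTorsionPoints 𝔼 = {x ∈ 𝔼 | x is of finite additive order in T}`, `𝔼 = puncturedTorus Φ`;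
* `mem_cuspidalTorsionPoints_iff_of` — the pointwise form.

The only hypothesis is the named fact Cor 2.3 (i) (FACT-LIST F-0074; being discharged by the L4-t7
lineage); nothing here bears on the disputed [IUTchIII] Cor. 3.12; typed ≠ proved for that input.
-/

namespace Literature.AnabelianGeometry.AbsoluteAnabelian

namespace HolomorphicEllipticCuspidalization

open Literature.Geometry.Kaehler (ComplexTorus)

/-- **Cor 2.7 (b) at the model, as an equality** (granted Cor 2.3 (i)): the cuspidal torsion points of
the punctured complex torus `𝔼 = T ∖ {0}` — the points off the image of some elliptic cuspidalization
diagram — are EXACTLY the points of `𝔼` of finite additive order in `T` ("one may construct the torsion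
points … as the points in the complement of the image of such morphisms `𝕌 ↪ 𝔼`").
[cite: MochizukiAbsTopIII2015, Corollary 2.7 (b) p.59] -/
theorem cuspidalTorsionPoints_eq_of (hRC : LocalMorphismIsRCHolomorphic) {ι : Type} [Fintype ι]
    (Φ : (ι → ℝ) ≃L[ℝ] ℂ) :
    cuspidalTorsionPoints ↥(puncturedTorus Φ) =
      {x : ↥(puncturedTorus Φ) | IsOfFinAddOrder (x : ComplexTorus Φ)} := by
  ext x
  refine ⟨fun hx => cuspidalTorsionPointsAreTorsion_of hRC ι Φ x hx, fun hx => ?_⟩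
  have hN : addOrderOf (x : ComplexTorus Φ) ≠ 0 :=
    (addOrderOf_pos_iff.2 (show IsOfFinAddOrder (x : ComplexTorus Φ) from hx)).ne'
  exact mem_cuspidalTorsionPoints_of_nsmul_eq_zero nsmulCovIsFiniteEtale_holds
    nsmulCovIsMorphism_holds nsmulDeckAbelianTransitive_holds nsmulImmIsMorphism_holds
    nsmulImmComplement_holds nsmulCoholomorphic_holds Φ hN x (addOrderOf_nsmul_eq_zero _)

/-- Pointwise form: granted Cor 2.3 (i), a point of the punctured torus is a cuspidal torsion point iff
it has finite additive order in `T`. [cite: MochizukiAbsTopIII2015, Corollary 2.7 (b) p.59] -/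
theorem mem_cuspidalTorsionPoints_iff_of (hRC : LocalMorphismIsRCHolomorphic) {ι : Type} [Fintype ι]
    (Φ : (ι → ℝ) ≃L[ℝ] ℂ) (x : ↥(puncturedTorus Φ)) :
    x ∈ cuspidalTorsionPoints ↥(puncturedTorus Φ) ↔ IsOfFinAddOrder (x : ComplexTorus Φ) := by
  rw [cuspidalTorsionPoints_eq_of hRC Φ]
  rfl

end HolomorphicEllipticCuspidalization

end Literature.AnabelianGeometry.AbsoluteAnabelian
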